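import Summits.QuantumFields.BalabanUV.T4Continuum.Support.OutputRateInsertion
import Summits.QuantumFields.BalabanUV.T4Continuum.Support.StepRecursion
import Summits.QuantumFields.BalabanUV.T4Continuum.Support.InsertionLinearClass

/-!
# B13HistInsertion — row O1-c (HISTORY ∕ TABLES) of the NE5 crux O1, part 2 of 2: the AFFINE AGE-WEIGHTED insertion class read
# from an insertion-operator datum; the printed-STRUCTURE binders and the insertion-operator species BY CONSTRUCTION; W3 from ONE
# age-free one-run binder (cell `pub-balaban`, T⁴ fan-out, `HOME/t4/b2b-balaban-t4-ne5-p1/O1-CLAIM-TABLE-NE5-P1.md` row O1-c;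
# design `B13StepDesign.md` v0.2 RULES R3, R3′)

Unit `b2b-balaban-t4-ne5-formalise-leaf-06` (NE5 formalisation swarm, leaf prover 06).  Summits-side NEW WORK under the LEAN
PLACEMENT RULE (cell modelling + bookkeeping; NOT a Literature module; the manuscripts under audit are cited for KIND ∕ locus
only, nothing of them is asserted).  HONEST FRAMING: rung (B)+1 of the FINITE-VOLUME T⁴ continuum programme — NOT infinite
volume, NOT a mass gap, NOT the Clay problem, NOT a proof of NE5 (NOT PRINTED: [Balaban1987RG1]–[Balaban1989LargeFieldII] print
ε-UNIFORM bounds, never two-spacing RATES; cell GAPS G-t4-U3-1).  HONEST DEPENDENCY (cell line, verbatim): continuum YM on T⁴ ⇐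
BetaPertH ∧ nine spine estimates (0/9 proved); BetaPertH ⇐ (D1) ∧ (D4) ∧ CAP+tail; G-an2-4 gates asym, D1 and NE2/3/4.

WHAT THIS FILE TYPES (definitions + by-construction bookkeeping; NO estimate).  The END faces of binder row NE5 consume run A's
history INSERTION `M.insA g U k : (C.Dom → ℝ) → Hist` of a `StepModel` through the printed-STRUCTURE binders `StepModel.InsAffine` ∕
`InsBlind` ∕ `InsHomog` ([II] Lemma 1 (1.33) p. 9, Lemma 2 (1.41) p. 11: the earlier actions enter LINEARLY and only scales `< k`
are read), the single-scale size bound `StepModel.InsScaleBoundLevel W κ c ω` (W3, cell gap G-ne5p1-3a″, with the printed age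
factor `ω^{k−1−j}` — KIND: the factors `Lʲη` of (1.24) p. 7, p. 8 *"This yields (6L)⁴Lʲη"*, (1.31) p. 9; [Balaban1987RG1]
(0.29)–(0.30) p. 258), run B's `StepRecursion.InsBlindB`, and the insertion-operator species `OutputRateInsertion.InsOpModel` with
its reading `ReadsIns` (W4 PRODUCED from an operator rate of the insertion operators).  Design RULE R3 ∕ R3′: the fine-lattice maps
`H, H₀, G̃, 𝐀₀` of (1.5) p. 3 through which §1 of [II] re-expresses the earlier actions are the INSERTION-OPERATOR DATUM, the
insertion is ONE functional of (datum, table) for both runs, affine in the table, with the age factors explicit.  Typed here: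
* `InsDatum C IOp Hist` (DATA): a table-independent part `base k a` (the `𝐏^{(k)}`-potentials of (1.41)), AGE-FREE single-scale
  insertion operators `slice k j a` — additive, real-homogeneous, reading only the scale-`j` entries of the table —, the age
  damping `ω` per unit of age, and the two runs' insertion-operator data `insOpA ∕ insOpB`; the insertion
  `ins k a t = base k a + Σ_{j<k} ω^{k−1−j} • slice k j a t` (newest scale undamped) and `insA ∕ insB` = `ins` read at the runs' data;
* under the readings `ReadsA` ∕ `ReadsB` (the step model's `insA` ∕ `insB` ARE these): `insAffine_of_readsA`, `insBlind_of_readsA`,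
  `insHomog_of_readsA`, `insBlindB_of_readsB` — the four structure binders BY CONSTRUCTION, no estimate;
* `SliceBudget` — the ONE displayed one-run binder of the class (AGE-FREE W3: a table supported on the scale `j < k` with entries
  `≤ T·e^{−κd}` is inserted, before age weighting, with norm `≤ rHist k·c·T`; NOT PRINTED as a statement about arbitrary tables —
  printed KIND: the `j`-th term of the one-run sums (1.24)∕(1.29)∕(1.36) at the inductive level) and
  `insScaleBoundLevel_of_sliceBudget : ReadsA → SliceBudget κ c → 0 ≤ ω → M.InsScaleBoundLevel W κ c ω` (the age factor is supplied
  by the class, not by the hypothesis);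
* `toInsOpModel` + `readsIns_of_reads` (the species of `OutputRateInsertion` IS this datum; `ReadsIns` by construction) and
  `insA_eq_of_transport_eq` (the insertion half of `StepRecursion.ReadsTransported` from a transport-reading of `insOpA`).
* §2 (file v1.1, ADDITIVE) `KernelDatum C IOp Hist` — the FINITE-RANK case (one kernel vector `ker k a Y : Hist` per earlier domain
  `Y ∈ dom k`, read from the insertion-operator datum): `toInsDatum` (slices = the scale fibres of the kernel sum; additive,
  homogeneous, local BY CONSTRUCTION) and the row text's reading «`insA` AS an `InsertionLinearClass.LinearInsertion` with the age
  factors INSIDE `vec`» (`linA`, `vec g U k Y = ω^{k−1−scale Y} • ker k (insOpA g U k) Y`; `linA_ins`: the two insertions COINCIDE, so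
  `reads_linA_iff`: P2's `Reads` ⟺ `ReadsA`), and the AGE-FREE kernel budget `KerBudget` (Σ_{Y ∈ dom k, scale Y = j} e^{−κd(Y)}‖ker‖
  ≤ rHist k·c, displayed binder) giving BOTH `SliceBudget` (`sliceBudget_of_kerBudget`) and P2's `AgeBudget … κ c ω`
  (`ageBudget_linA_of_kerBudget`) — one binder, two routes to W3, no estimate of [II].
MODELLING NOTE (booked for the row owner; the kernel makes no claim either way).  The finite-rank class
`InsertionLinearClass.LinearInsertion` (`ins = base + Σ_{Y ∈ dom k} t(Y) • vec Y`, `dom k` a `Finset`) is the special case in which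
every `slice k j a` has finite rank; finiteness is NOT assumed here, because in (1.33) the earlier terms `𝐄^{(j)}(X, ·)` enter as
FUNCTIONS of the background (through `U_k(exp iB′V^{(k)})` and the Cauchy formula (1.23) p. 7 at complex parameters), so a
rank-one reading in the real table entry `t(X)` presupposes that the carriers' `Dom` indexes the background argument as well
(row O1-a's choice).  WHAT IS NOT HERE: no estimate of [II] (`SliceBudget` is a binder); no `StepModel` instance; the space `Hist`
is arbitrary (part 1 `B13HistDatum` supplies the potential tables).  0 sorry; axioms ⊆ {propext, Classical.choice, Quot.sound}.
-/

noncomputable section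

open scoped BigOperators
open Finset

namespace Summit.QuantumFields.BalabanUV.T4Continuum.B13HistInsertion

open Literature.MathematicalPhysics.QuantumFieldTheory.Balaban1983to89
open Literature.MathematicalPhysics.QuantumFieldTheory.Balaban1983to89.T4OutputRate (Carriers)
open Literature.MathematicalPhysics.QuantumFieldTheory.Balaban1983to89.T4InputCauchyRateData (StepModel)
open Summit.QuantumFields.BalabanUV.T4Continuum.OutputRateInsertion (InsOpModel)
open Summit.QuantumFields.BalabanUV.T4Continuum.StepRecursion (InsBlindB)

section Insertion

variable {C : Carriers} {IOp Op Hist : Type*} [NormedAddCommGroup Op] [NormedSpace ℂ Op] [NormedAddCommGroup Hist]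
  [NormedSpace ℂ Hist]

/-- [folklore] DATA (no inequality inside): an INSERTION DATUM.  `base k a` = the table-independent part of the step-`k` inserted
history computed from the insertion-operator datum `a` (in [II]: the `𝐏^{(k)}`-potentials of (1.41), from the expansion of the
Wilson action and of the measure); `slice k j a t` = the AGE-FREE insertion at step `k` of the scale-`j` entries of the table `t`
(in [II]: the localized re-expression (1.33) of the scale-`j` earlier terms through the step's fine-lattice maps — RULE R3: every
fine-lattice η-dependence sits in `a`), additive and real-homogeneous in the table and reading only its scale-`j` entries;
`ω` = the age damping per unit of age (printed KIND: the factors `Lʲη` of (1.24) p. 7 ∕ p. 8 ∕ (1.31) p. 9, [Balaban1987RG1]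
(0.29)–(0.30) p. 258); `insOpA ∕ insOpB` = the two runs' insertion-operator data. -/
structure InsDatum (C : Carriers) (IOp Hist : Type*) [NormedAddCommGroup Hist] [NormedSpace ℂ Hist] where
  /-- table-independent part -/
  base : ℕ → IOp → Hist
  /-- age-free single-scale insertion operators -/
  slice : ℕ → ℕ → IOp → (C.Dom → ℝ) → Hist
  slice_add : ∀ k j a t t', slice k j a (t + t') = slice k j a t + slice k j a t'
  slice_smul : ∀ k j a (r : ℝ) t, slice k j a (r • t) = (r : ℂ) • slice k j a t
  /-- `slice k j a` reads only the scale-`j` entries -/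
  slice_local : ∀ k j a t t', (∀ Y, C.scale Y = j → t Y = t' Y) → slice k j a t = slice k j a t'
  /-- age damping per unit of age -/
  ω : ℝ
  /-- run A's insertion-operator data (at the transported background) -/
  insOpA : (ℕ → ℝ) → C.BgB → ℕ → IOp
  /-- run B's insertion-operator data -/
  insOpB : (ℕ → ℝ) → C.BgB → ℕ → IOp

namespace InsDatum

variable (D : InsDatum C IOp Hist)

/-- [folklore] THE INSERTION of the datum: `base + Σ_{j<k} ω^{k−1−j} • slice k j` (the newest scale `j = k − 1` undamped). -/
def ins (k : ℕ) (a : IOp) (t : C.Dom → ℝ) : Hist :=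
  D.base k a + ∑ j ∈ range k, ((D.ω ^ (k - 1 - j) : ℝ) : ℂ) • D.slice k j a t

/-- [folklore] Run A's insertion maps: the insertion read at run A's insertion-operator datum. -/
def insA (g : ℕ → ℝ) (U : C.BgB) (k : ℕ) (t : C.Dom → ℝ) : Hist := D.ins k (D.insOpA g U k) t

/-- [folklore] Run B's insertion maps. -/
def insB (g : ℕ → ℝ) (U : C.BgB) (k : ℕ) (t : C.Dom → ℝ) : Hist := D.ins k (D.insOpB g U k) t

/-- [folklore] The age-free slices vanish on the zero table (real homogeneity at `0`). -/
theorem slice_zero (k j : ℕ) (a : IOp) : D.slice k j a 0 = 0 := by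
  have h := D.slice_smul k j a 0 0
  rwa [zero_smul, Complex.ofReal_zero, zero_smul] at h

/-- [folklore] The slices are subtractive. -/
theorem slice_sub (k j : ℕ) (a : IOp) (t t' : C.Dom → ℝ) :
    D.slice k j a (t - t') = D.slice k j a t - D.slice k j a t' := by
  have h := D.slice_add k j a (t - t') t'
  rw [sub_add_cancel] at h
  exact eq_sub_of_add_eq h.symm

/-- [folklore] Differences of insertions at one datum are the age-weighted sums of the slices of the difference table. -/
theorem ins_sub_ins (k : ℕ) (a : IOp) (t t' : C.Dom → ℝ) :
    D.ins k a t - D.ins k a t' = ∑ j ∈ range k, ((D.ω ^ (k - 1 - j) : ℝ) : ℂ) • D.slice k j a (t - t') := by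
  simp only [ins, add_sub_add_left_eq_sub, ← Finset.sum_sub_distrib, ← smul_sub, ← slice_sub]

/-- [folklore] HYPOTHESIS SHAPE (reading): on the window, run A's insertion of the step model IS the datum's. -/
def ReadsA (M : StepModel C Op Hist) (W : Set (ℕ → ℝ)) : Prop :=
  ∀ k, ∀ g ∈ W, ∀ (U : C.BgB) (t : C.Dom → ℝ), M.insA g U k t = D.insA g U k t

/-- [folklore] HYPOTHESIS SHAPE (reading): on the window, run B's insertion of the step model IS the datum's. -/
def ReadsB (M : StepModel C Op Hist) (W : Set (ℕ → ℝ)) : Prop :=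
  ∀ k, ∀ g ∈ W, ∀ (U : C.BgB) (t : C.Dom → ℝ), M.insB g U k t = D.insB g U k t

/-- [folklore] HYPOTHESIS SHAPE `SliceBudget κ c` — the ONE displayed one-run binder of the class (AGE-FREE W3; NOT PRINTED as a
statement about arbitrary single-scale tables — printed KIND: the `j`-th term of the one-run sums (1.24) ∕ (1.29) ∕ (1.36) of [II]
and (0.29)–(0.30) of [Balaban1987RG1] at the inductive level, BEFORE the age factor): a table supported on the scale `j < k` with
entries `≤ T·e^{−κd}` is inserted at step `k`, at run A's insertion-operator datum and before age weighting, with norm at most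
`c·T` history margins. -/
def SliceBudget (M : StepModel C Op Hist) (W : Set (ℕ → ℝ)) (κ c : ℝ) : Prop :=
  ∀ k, ∀ g ∈ W, ∀ (U : C.BgB) (j : ℕ) (T : ℝ) (t : C.Dom → ℝ), j < k → 0 ≤ T →
    (∀ Y, C.scale Y ≠ j → t Y = 0) → (∀ Y, C.scale Y = j → |t Y| ≤ T * Real.exp (-(κ * C.d Y))) →
      ‖D.slice k j (D.insOpA g U k) t‖ ≤ M.rHist k * (c * T)

variable {D} {M : StepModel C Op Hist} {W : Set (ℕ → ℝ)}

/-- [folklore] **`InsAffine` BY CONSTRUCTION.** -/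
theorem insAffine_of_readsA (h : D.ReadsA M W) : M.InsAffine W := by
  intro k g hg U t t'
  rw [h k g hg U t, h k g hg U t', h k g hg U (t - t'), h k g hg U 0, insA, insA, insA, insA, ins_sub_ins, ins_sub_ins,
    sub_zero]

/-- [folklore] **`InsBlind` BY CONSTRUCTION**: only the slices `j < k` occur, each reading its own scale. -/
theorem insBlind_of_readsA (h : D.ReadsA M W) : M.InsBlind W := by
  intro k g hg U t t' htt'
  rw [h k g hg U t, h k g hg U t', insA, insA, ins, ins]
  congr 1
  refine Finset.sum_congr rfl fun j hj => ?_
  rw [D.slice_local k j _ t t' fun Y hY => htt' Y (hY ▸ mem_range.1 hj)]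

/-- [folklore] **`InsHomog` BY CONSTRUCTION.** -/
theorem insHomog_of_readsA (h : D.ReadsA M W) : M.InsHomog W := by
  intro k g hg U r t
  rw [h k g hg U (r • t), h k g hg U 0, h k g hg U t, insA, insA, insA, ins_sub_ins, ins_sub_ins, sub_zero, sub_zero,
    Finset.smul_sum]
  refine Finset.sum_congr rfl fun j _ => ?_
  rw [D.slice_smul, smul_comm]

/-- [folklore] **`StepRecursion.InsBlindB` BY CONSTRUCTION** (the run-B twin, used by `StepRecursion.representsB_recB`). -/
theorem insBlindB_of_readsB (h : D.ReadsB M W) : InsBlindB M W := by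
  intro k g hg U t t' htt'
  rw [h k g hg U t, h k g hg U t', insB, insB, ins, ins]
  congr 1
  refine Finset.sum_congr rfl fun j hj => ?_
  rw [D.slice_local k j _ t t' fun Y hY => htt' Y (hY ▸ mem_range.1 hj)]

/-- [folklore] The three run-A structure binders of the END faces at once. -/
theorem structure_of_readsA (h : D.ReadsA M W) : M.InsAffine W ∧ M.InsBlind W ∧ M.InsHomog W :=
  ⟨insAffine_of_readsA h, insBlind_of_readsA h, insHomog_of_readsA h⟩

/-- [folklore] A single-scale table is inserted through its own slice only: for `t` supported on the scale `j < k`,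
`ins k a t − ins k a 0 = ω^{k−1−j} • slice k j a t`. -/
theorem ins_sub_ins_zero_of_single (k : ℕ) (a : IOp) {t : C.Dom → ℝ} {j : ℕ} (hj : j < k)
    (hsupp : ∀ Y, C.scale Y ≠ j → t Y = 0) :
    D.ins k a t - D.ins k a 0 = ((D.ω ^ (k - 1 - j) : ℝ) : ℂ) • D.slice k j a t := by
  rw [ins_sub_ins, sub_zero]
  refine Finset.sum_eq_single j (fun i _ hij => ?_) (fun hjk => absurd (mem_range.2 hj) hjk)
  rw [D.slice_local k i a t 0 fun Y hY => hsupp Y (hY ▸ hij), slice_zero, smul_zero]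

/-- [folklore] **W3 FROM THE AGE STRUCTURE + ONE AGE-FREE BINDER**: `ReadsA ∧ SliceBudget κ c ∧ 0 ≤ ω ⟹
M.InsScaleBoundLevel W κ c ω` — the printed age factor is supplied by the class, not by the hypothesis. -/
theorem insScaleBoundLevel_of_sliceBudget {κ c : ℝ} (h : D.ReadsA M W) (hb : D.SliceBudget M W κ c) (hω : 0 ≤ D.ω) :
    M.InsScaleBoundLevel W κ c D.ω := by
  intro k g hg U t j T hj hT hsupp hbd
  rw [h k g hg U t, h k g hg U 0, insA, insA, D.ins_sub_ins_zero_of_single k _ hj hsupp, norm_smul, Complex.norm_real,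
    Real.norm_eq_abs, abs_of_nonneg (pow_nonneg hω _)]
  calc D.ω ^ (k - 1 - j) * ‖D.slice k j (D.insOpA g U k) t‖ ≤ D.ω ^ (k - 1 - j) * (M.rHist k * (c * T)) :=
        mul_le_mul_of_nonneg_left (hb k g hg U j T t hj hT hsupp hbd) (pow_nonneg hω _)
    _ = M.rHist k * (c * (D.ω ^ (k - 1 - j) * T)) := by ring

variable (D M)

/-- [folklore] The insertion-operator SPECIES of the datum for the step model `M` (margin `rI`): the one functional `ins`, read at
the two runs' insertion-operator data (`OutputRateInsertion.InsOpModel`). -/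
def toInsOpModel [NormedAddCommGroup IOp] [NormedSpace ℂ IOp] (rI : ℕ → ℝ) (hrI : ∀ k, 0 < rI k) : InsOpModel M IOp where
  Ins := D.ins
  opIA := D.insOpA
  opIB := D.insOpB
  rI := rI
  rI_pos := hrI

variable {D M}

/-- [folklore] **`ReadsIns` BY CONSTRUCTION**: under both readings the step model's insertions ARE the species' functional at
the runs' own data. -/
theorem readsIns_of_reads [NormedAddCommGroup IOp] [NormedSpace ℂ IOp] {rI : ℕ → ℝ} {hrI : ∀ k, 0 < rI k}
    (hA : D.ReadsA M W) (hB : D.ReadsB M W) : (D.toInsOpModel M rI hrI).ReadsIns W :=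
  fun k g hg U t => ⟨hA k g hg U t, hB k g hg U t⟩

/-- [folklore] The insertion half of `StepRecursion.ReadsTransported`: if run A's insertion-operator data depend on the run-B
background only through the transport, so do run A's insertion maps. -/
theorem insA_eq_of_transport_eq (hA : D.ReadsA M W)
    (hT : ∀ g ∈ W, ∀ U U' : C.BgB, C.transport U = C.transport U' → ∀ k, D.insOpA g U k = D.insOpA g U' k)
    {g : ℕ → ℝ} (hg : g ∈ W) {U U' : C.BgB} (hUU' : C.transport U = C.transport U') (k : ℕ) (t : C.Dom → ℝ) :
    M.insA g U k t = M.insA g U' k t := by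
  rw [hA k g hg U t, hA k g hg U' t, insA, insA, hT g hg U U' hUU' k]

end InsDatum

end Insertion

/-! ## §2 (file v1.1, ADDITIVE) Finite-rank kernels: the `InsertionLinearClass.LinearInsertion` reading with the age factors
## INSIDE `vec`, and both W3 binders from ONE age-free kernel budget -/

section FiniteRank

open Summit.QuantumFields.BalabanUV.T4Continuum.InsertionLinearClass (LinearInsertion)

variable {C : Carriers} {IOp Op Hist : Type*} [NormedAddCommGroup Op] [NormedSpace ℂ Op] [NormedAddCommGroup Hist]
  [NormedSpace ℂ Hist]

/-- [folklore] DATA (no inequality inside): FINITE-RANK INSERTION KERNELS read from an insertion-operator datum — at step `k` a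
finite set `dom k` of earlier domains (scales `< k`), the table-independent part `base k a`, ONE age-free kernel vector `ker k a Y`
per earlier domain, the age damping `ω`, and the two runs' insertion-operator data.  (The special case of `InsDatum` in which
every slice has finite rank; whether [II]'s (1.33) is of this kind is the MODELLING NOTE of the header — no claim here.) -/
structure KernelDatum (C : Carriers) (IOp Hist : Type*) [NormedAddCommGroup Hist] [NormedSpace ℂ Hist] where
  /-- the earlier domains read at step `k` -/
  dom : ℕ → Finset C.Dom
  /-- only scales `< k` are read -/
  dom_lt : ∀ k, ∀ Y ∈ dom k, C.scale Y < k
  /-- table-independent part -/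
  base : ℕ → IOp → Hist
  /-- the age-free kernel vector of the earlier domain `Y` at step `k` -/
  ker : ℕ → IOp → C.Dom → Hist
  /-- age damping per unit of age -/
  ω : ℝ
  /-- run A's insertion-operator data -/
  insOpA : (ℕ → ℝ) → C.BgB → ℕ → IOp
  /-- run B's insertion-operator data -/
  insOpB : (ℕ → ℝ) → C.BgB → ℕ → IOp

namespace KernelDatum

variable (K : KernelDatum C IOp Hist)

/-- [folklore] The scale-`j` fibre of the read domains at step `k`. -/
def fibre (k j : ℕ) : Finset C.Dom := (K.dom k).filter fun Y => C.scale Y = j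

/-- [folklore] The age-free slice of the kernels: the scale-`j` part of the kernel sum. -/
def slice (k j : ℕ) (a : IOp) (t : C.Dom → ℝ) : Hist := ∑ Y ∈ K.fibre k j, ((t Y : ℝ) : ℂ) • K.ker k a Y

/-- [folklore] The kernels as an `InsDatum` (additivity, homogeneity and locality of the slices BY CONSTRUCTION). -/
def toInsDatum : InsDatum C IOp Hist where
  base := K.base
  slice := K.slice
  slice_add k j a t t' := by
    simp only [slice, Pi.add_apply, Complex.ofReal_add, add_smul, Finset.sum_add_distrib]
  slice_smul k j a r t := by
    simp only [slice, Pi.smul_apply, smul_eq_mul, Complex.ofReal_mul, mul_smul, Finset.smul_sum]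
  slice_local k j a t t' htt' := by
    refine Finset.sum_congr rfl fun Y hY => ?_
    rw [htt' Y (Finset.mem_filter.1 hY).2]
  ω := K.ω
  insOpA := K.insOpA
  insOpB := K.insOpB

/-- [folklore] THE ROW TEXT'S READING: run A's insertion AS P2's `LinearInsertion`, with the AGE FACTORS INSIDE `vec`
(`vec g U k Y = ω^{k−1−scale Y} • ker k (insOpA g U k) Y`; design Q4). -/
def linA : LinearInsertion C Hist where
  dom := K.dom
  dom_lt := K.dom_lt
  base g U k := K.base k (K.insOpA g U k)
  vec g U k Y := ((K.ω ^ (k - 1 - C.scale Y) : ℝ) : ℂ) • K.ker k (K.insOpA g U k) Y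

/-- [folklore] The kernel sum resolved into its scale fibres: `Σ_{Y ∈ dom k} = Σ_{j<k} Σ_{Y ∈ fibre k j}`. -/
theorem sum_dom_eq_sum_fibre (k : ℕ) (f : C.Dom → Hist) :
    ∑ Y ∈ K.dom k, f Y = ∑ j ∈ range k, ∑ Y ∈ K.fibre k j, f Y :=
  (Finset.sum_fiberwise_of_maps_to (g := C.scale) (fun Y hY => mem_range.2 (K.dom_lt k Y hY)) f).symm

/-- [folklore] **THE TWO INSERTIONS COINCIDE**: P2's `LinearInsertion.ins` of `linA` IS the `InsDatum` insertion `insA` of the kernels. -/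
theorem linA_ins (g : ℕ → ℝ) (U : C.BgB) (k : ℕ) (t : C.Dom → ℝ) : K.linA.ins g U k t = K.toInsDatum.insA g U k t := by
  simp only [LinearInsertion.ins, linA, InsDatum.insA, InsDatum.ins, toInsDatum, slice]
  congr 1
  rw [K.sum_dom_eq_sum_fibre]
  refine Finset.sum_congr rfl fun j _ => ?_
  rw [Finset.smul_sum]
  refine Finset.sum_congr rfl fun Y hY => ?_
  rw [(Finset.mem_filter.1 hY).2, smul_comm]

/-- [folklore] Hence P2's reading `LinearInsertion.Reads` of `linA` and this file's `ReadsA` of the kernels are the same hypothesis. -/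
theorem reads_linA_iff (M : StepModel C Op Hist) (W : Set (ℕ → ℝ)) : K.linA.Reads M W ↔ K.toInsDatum.ReadsA M W := by
  simp only [LinearInsertion.Reads, InsDatum.ReadsA, linA_ins]

/-- [folklore] HYPOTHESIS SHAPE `KerBudget κ c` (the AGE-FREE one-run binder of the finite-rank class, displayed; NOT PRINTED as a
statement about kernel vectors — printed KIND as for `InsDatum.SliceBudget`): at step `k` and run A's datum the `e^{−κd}`-weighted
ℓ¹ sum of the scale-`j` kernel vectors is at most `c` history margins, BEFORE the age factor. -/
def KerBudget (M : StepModel C Op Hist) (W : Set (ℕ → ℝ)) (κ c : ℝ) : Prop :=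
  ∀ k, ∀ g ∈ W, ∀ (U : C.BgB) (j : ℕ), j < k →
    ∑ Y ∈ K.fibre k j, Real.exp (-(κ * C.d Y)) * ‖K.ker k (K.insOpA g U k) Y‖ ≤ M.rHist k * c

variable {K} {M : StepModel C Op Hist} {W : Set (ℕ → ℝ)} {κ c : ℝ}

/-- [folklore] A single-scale table of level `T` drives the slice by at most `T ×` the weighted kernel sum (triangle inequality). -/
theorem norm_slice_le (k j : ℕ) (a : IOp) {t : C.Dom → ℝ} {T : ℝ}
    (hbd : ∀ Y, C.scale Y = j → |t Y| ≤ T * Real.exp (-(κ * C.d Y))) :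
    ‖K.slice k j a t‖ ≤ T * ∑ Y ∈ K.fibre k j, Real.exp (-(κ * C.d Y)) * ‖K.ker k a Y‖ := by
  rw [slice, Finset.mul_sum]
  refine (norm_sum_le _ _).trans (Finset.sum_le_sum fun Y hY => ?_)
  rw [norm_smul, Complex.norm_real, Real.norm_eq_abs]
  calc |t Y| * ‖K.ker k a Y‖ ≤ T * Real.exp (-(κ * C.d Y)) * ‖K.ker k a Y‖ :=
        mul_le_mul_of_nonneg_right (hbd Y (Finset.mem_filter.1 hY).2) (norm_nonneg _)
    _ = T * (Real.exp (-(κ * C.d Y)) * ‖K.ker k a Y‖) := by ring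

/-- [folklore] **`SliceBudget` FROM THE KERNEL BUDGET** (route 1 to W3: then `InsDatum.insScaleBoundLevel_of_sliceBudget`). -/
theorem sliceBudget_of_kerBudget (hb : K.KerBudget M W κ c) : K.toInsDatum.SliceBudget M W κ c := by
  intro k g hg U j T t hj hT _ hbd
  calc ‖K.slice k j (K.insOpA g U k) t‖
      ≤ T * ∑ Y ∈ K.fibre k j, Real.exp (-(κ * C.d Y)) * ‖K.ker k (K.insOpA g U k) Y‖ := norm_slice_le k j _ hbd
    _ ≤ T * (M.rHist k * c) := mul_le_mul_of_nonneg_left (hb k g hg U j hj) hT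
    _ = M.rHist k * (c * T) := by ring

/-- [folklore] **P2's `AgeBudget` FROM THE SAME KERNEL BUDGET** (route 2 to W3: then
`InsertionLinearClass.LinearInsertion.insScaleBoundLevel_of_ageBudget`): the age factor inside `vec` comes out of the fibre sum. -/
theorem ageBudget_linA_of_kerBudget (hb : K.KerBudget M W κ c) (hω : 0 ≤ K.ω) : K.linA.AgeBudget M W κ c K.ω := by
  intro k g hg U j hj
  have hfib : ∀ Y ∈ K.fibre k j, Real.exp (-(κ * C.d Y)) * ‖K.linA.vec g U k Y‖ =
      K.ω ^ (k - 1 - j) * (Real.exp (-(κ * C.d Y)) * ‖K.ker k (K.insOpA g U k) Y‖) := fun Y hY => by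
    simp only [linA, norm_smul, Complex.norm_real, Real.norm_eq_abs, abs_of_nonneg (pow_nonneg hω _),
      (Finset.mem_filter.1 hY).2]
    ring
  calc ∑ Y ∈ (K.linA.dom k).filter (fun Y => C.scale Y = j), Real.exp (-(κ * C.d Y)) * ‖K.linA.vec g U k Y‖
      = ∑ Y ∈ K.fibre k j, K.ω ^ (k - 1 - j) * (Real.exp (-(κ * C.d Y)) * ‖K.ker k (K.insOpA g U k) Y‖) :=
        Finset.sum_congr rfl hfib
    _ = K.ω ^ (k - 1 - j) * ∑ Y ∈ K.fibre k j, Real.exp (-(κ * C.d Y)) * ‖K.ker k (K.insOpA g U k) Y‖ := by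
        rw [Finset.mul_sum]
    _ ≤ K.ω ^ (k - 1 - j) * (M.rHist k * c) := mul_le_mul_of_nonneg_left (hb k g hg U j hj) (pow_nonneg hω _)
    _ = M.rHist k * (c * K.ω ^ (k - 1 - j)) := by ring

/-- [folklore] The finite-rank class delivers W3 for the step model: `ReadsA ∧ KerBudget κ c ∧ 0 ≤ ω ⟹ M.InsScaleBoundLevel W κ c ω`. -/
theorem insScaleBoundLevel_of_kerBudget (h : K.toInsDatum.ReadsA M W) (hb : K.KerBudget M W κ c) (hω : 0 ≤ K.ω) :
    M.InsScaleBoundLevel W κ c K.ω :=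
  InsDatum.insScaleBoundLevel_of_sliceBudget h (sliceBudget_of_kerBudget hb) hω

end KernelDatum

end FiniteRank

end Summit.QuantumFields.BalabanUV.T4Continuum.B13HistInsertion

end
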